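import Literature.Analysis.Convex.MinMax
import Literature.Probability.Moments.HoeffdingCounting
import Literature.Computability.Complexity.MajorityCircuit
import Literature.Computability.Complexity.CircuitClassesProofs
import HarnessLib

/-!
# Impagliazzo's hard-core lemma, min-max (measure) form (Goldreich–Nisan–Wigderson, *On Yao's XOR-Lemma*, App. A, Claim 12.1)

The first part of Impagliazzo's hard-core lemma (Impagliazzo 1995; Goldreich–Nisan–Wigderson,
*On Yao's XOR-Lemma*, App. A, Lemma 12 / Claim 12.1; Goldreich 2008, Thm. 7.21 / Claim 7.21.1;
Arora–Barak 2009, Thm. 19.2 "Impagliazzo's hard-core lemma"), for the uniform distribution on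
`{0,1}ⁿ` and `B₂`-circuits, fully proved:

* `hoeffding_lemma_weighted`, `hoeffding_weighted_pi` — Hoeffding's lemma/inequality under a
  finite product of (real-weighted) distributions (the counting form of
  `Probability/Moments/HoeffdingCounting.lean` with weights), `exists_not_of_weight_lt_one` (the
  probabilistic method), `sum_biUnion_le_sum` (union bound);
* `vote`, `exists_majority_sample` — for a distribution `q` on predictors, some fixed
  `(2m+1)`-sample has a majority right wherever the `q`-vote is `≥ 1/2 + ε`, once
  `|Ω| e^{-(2m+1)ε²/2} < 1`; `cktSize_majority_sample` — the majority circuit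
  (`MajorityCircuit.cktSize_maj`), size `(2m+1) s' + 9m + 3`;
* **`exists_hardCore_measure`** — if every `B₂`-circuit of size `≤ s` errs on `≥ k` inputs of
  `f : {0,1}ⁿ → {0,1}`, then some probability distribution `p` with `p(x) ≤ 1/k` (density `k`:
  `k/2ⁿ`-dominated by uniform) has every circuit of size `≤ s'` agreeing with `f` with
  `p`-probability `≤ 1/2 + ε`, for `(2m+1) s' + 9m + 3 ≤ s`, `2ⁿ e^{-(2m+1)ε²/2} < 1`. Proof as
  printed: the min-max principle (`Analysis/Convex/MinMax.lean`) in the game "`k`-subset versus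
  small circuit", then majority amplification of the circuit player's mixed strategy.

Relation to the tree: `HardCoreLemma.lean` (namespace `HardCore`, `exists_majority_correct`) is
the CONTRAPOSITIVE/boosting form with integer-capped measures and an abstract predictor class,
proved by Impagliazzo's iterative argument without min-max; this file is the classical EXISTENTIAL
form (an actual dominated probability distribution hard for all small `B₂`-circuits), by von
Neumann's min-max principle, as printed in GNW/Goldreich — the form from which hard-core SETS are
sampled (Claims 12.2–12.3, not in this file; the union bound there uses `CircuitCounting.lean`).
The namespace here is `HardCoreMinMax`.

## References

* R. Impagliazzo, *Hard-core distributions for somewhat hard problems*, FOCS 1995.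
* O. Goldreich, N. Nisan, A. Wigderson, *On Yao's XOR-Lemma*, in: O. Goldreich (ed.), *Studies in
  Complexity and Cryptography*, LNCS 6650 (2011), App. A, Lemma 12 and Claim 12.1 (text: galaxy
  panama 322088187461687, checked).
* O. Goldreich, *Computational Complexity: A Conceptual Perspective*, CUP 2008, Thm. 7.21,
  Claim 7.21.1.
* S. Arora, B. Barak, *Computational Complexity: A Modern Approach*, CUP 2009, Thm. 19.2
  [AroraBarakCC2009].
-/

noncomputable section

open Finset Real

namespace Literature.Computability.Complexity

namespace HardCoreMinMax

/-! ### Weighted Hoeffding on a finite product of distributions -/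

/-- **Hoeffding's lemma, weighted form**: for a distribution `w` on a finite type (`w ≥ 0`,
`Σ w = 1`), a `w`-mean-zero `f` with `|f| ≤ c` has `Σ_a w(a) exp(λ f(a)) ≤ exp(λ² c² / 2)`. [folklore] -/
theorem hoeffding_lemma_weighted {α : Type*} [Fintype α] (w f : α → ℝ) {c : ℝ} (hw : ∀ a, 0 ≤ w a)
    (hw1 : ∑ a, w a = 1) (hf0 : ∑ a, w a * f a = 0) (hfc : ∀ a, |f a| ≤ c) (l : ℝ) :
    ∑ a, w a * Real.exp (l * f a) ≤ Real.exp (l ^ 2 * c ^ 2 / 2) := by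
  obtain ⟨a₀, ha₀⟩ : ∃ a, 0 < w a := by
    by_contra h; push Not at h
    have : ∑ a, w a = 0 := sum_eq_zero fun a _ => le_antisymm (h a) (hw a)
    rw [hw1] at this; exact one_ne_zero this
  have hc0 : 0 ≤ c := (abs_nonneg _).trans (hfc a₀)
  rcases hc0.eq_or_lt with rfl | hc
  · have hf : ∀ a, f a = 0 := fun a => abs_nonpos_iff.1 (hfc a)
    simp [hf, hw1]
  calc ∑ a, w a * Real.exp (l * f a)
      ≤ ∑ a, w a * (((c - f a) * Real.exp (-(l * c)) + (c + f a) * Real.exp (l * c)) / (2 * c)) :=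
        sum_le_sum fun a _ => mul_le_mul_of_nonneg_left (Literature.Probability.Moments.exp_mul_le_chord hc (hfc a) l) (hw a)
    _ = (∑ a, w a) * ((Real.exp (-(l * c)) + Real.exp (l * c)) / 2) +
          (∑ a, w a * f a) * ((Real.exp (l * c) - Real.exp (-(l * c))) / (2 * c)) := by
        rw [sum_mul, sum_mul, ← sum_add_distrib]
        refine sum_congr rfl fun a _ => ?_
        field_simp
        ring
    _ = Real.cosh (l * c) := by rw [hw1, hf0, zero_mul, add_zero, one_mul, Real.cosh_eq]; ring_nf
    _ ≤ Real.exp (l ^ 2 * c ^ 2 / 2) := by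
        calc Real.cosh (l * c) ≤ Real.exp ((l * c) ^ 2 / 2) := Real.cosh_le_exp_half_sq _
          _ = Real.exp (l ^ 2 * c ^ 2 / 2) := by ring_nf

/-- **Hoeffding's inequality, weighted form on a finite product of distributions** (one-sided):
under the product weight `W(y) = ∏_i w_i(y_i)` of distributions `w_i`, for `w_i`-mean-zero `f_i`
with `|f_i| ≤ c_i` and `t ≥ 0`, the `W`-mass of `{y : Σ_i f_i(y_i) ≥ t}` is at most
`exp(-t² / (2 Σ_i c_i²))`. [folklore] -/
theorem hoeffding_weighted_pi {ι : Type*} [Fintype ι] [DecidableEq ι] {κ : ι → Type*} [∀ i, Fintype (κ i)]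
    (w : ∀ i, κ i → ℝ) (f : ∀ i, κ i → ℝ) (c : ι → ℝ) (hw : ∀ i a, 0 ≤ w i a) (hw1 : ∀ i, ∑ a, w i a = 1)
    (hf0 : ∀ i, ∑ a, w i a * f i a = 0) (hfc : ∀ i a, |f i a| ≤ c i) {t : ℝ} (ht : 0 ≤ t) (hS : 0 < ∑ i, c i ^ 2) :
    ∑ y ∈ Finset.univ.filter (fun y : (∀ i, κ i) => t ≤ ∑ i, f i (y i)), ∏ i, w i (y i) ≤
      Real.exp (-(t ^ 2 / (2 * ∑ i, c i ^ 2))) := by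
  classical
  set S : ℝ := ∑ i, c i ^ 2 with hSdef
  set l : ℝ := t / S with hl
  have hl0 : 0 ≤ l := by positivity
  set E := Finset.univ.filter fun y : (∀ i, κ i) => t ≤ ∑ i, f i (y i) with hE
  have hW : ∀ y : (∀ i, κ i), 0 ≤ ∏ i, w i (y i) := fun y => prod_nonneg fun i _ => hw i (y i)
  -- `mass(E) · exp(λ t) ≤ Σ_y W(y) exp(λ Σ f) = ∏_i Σ_a w_i a exp(λ f_i a) ≤ exp(λ² S / 2)`
  have h1 : (∑ y ∈ E, ∏ i, w i (y i)) * Real.exp (l * t) ≤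
      ∑ y : (∀ i, κ i), (∏ i, w i (y i)) * Real.exp (l * ∑ i, f i (y i)) := by
    rw [sum_mul]
    refine (sum_le_sum fun y hy => ?_).trans
      (sum_le_sum_of_subset_of_nonneg (filter_subset _ _) fun y _ _ => mul_nonneg (hW y) (Real.exp_pos _).le)
    rw [hE, mem_filter] at hy
    exact mul_le_mul_of_nonneg_left (Real.exp_le_exp.2 (mul_le_mul_of_nonneg_left hy.2 hl0)) (hW y)
  have h2 : ∑ y : (∀ i, κ i), (∏ i, w i (y i)) * Real.exp (l * ∑ i, f i (y i)) =
      ∏ i, ∑ a : κ i, w i a * Real.exp (l * f i a) := by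
    simp_rw [mul_sum, Real.exp_sum, ← prod_mul_distrib]
    exact (prod_univ_sum (fun _ => Finset.univ) fun i a => w i a * Real.exp (l * f i a)).symm
  have h3 : ∏ i, ∑ a : κ i, w i a * Real.exp (l * f i a) ≤ ∏ i, Real.exp (l ^ 2 * c i ^ 2 / 2) :=
    prod_le_prod (fun i _ => sum_nonneg fun a _ => mul_nonneg (hw i a) (Real.exp_pos _).le)
      fun i _ => hoeffding_lemma_weighted (w i) (f i) (hw i) (hw1 i) (hf0 i) (hfc i) l
  have h4 : ∏ i, Real.exp (l ^ 2 * c i ^ 2 / 2) = Real.exp (l ^ 2 * S / 2) := by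
    rw [← Real.exp_sum, hSdef, mul_sum, sum_div]
  have h5 : (∑ y ∈ E, ∏ i, w i (y i)) * Real.exp (l * t) ≤ Real.exp (l ^ 2 * S / 2) := by
    calc _ ≤ _ := h1
      _ = _ := h2
      _ ≤ _ := h3
      _ = _ := h4
  have h6 : ∑ y ∈ E, ∏ i, w i (y i) ≤ Real.exp (l ^ 2 * S / 2 - l * t) := by
    rw [Real.exp_sub, le_div_iff₀ (Real.exp_pos _)]
    exact h5
  have h7 : l ^ 2 * S / 2 - l * t = -(t ^ 2 / (2 * S)) := by
    rw [hl]; field_simp; ring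
  rwa [h7] at h6

/-- The total weight of a product of distributions is `1`. [folklore] -/
theorem sum_prod_weights {ι : Type*} [Fintype ι] [DecidableEq ι] {κ : ι → Type*} [∀ i, Fintype (κ i)]
    (w : ∀ i, κ i → ℝ) (hw1 : ∀ i, ∑ a, w i a = 1) : ∑ y : (∀ i, κ i), ∏ i, w i (y i) = 1 := by
  have := (prod_univ_sum (fun _ => Finset.univ) fun i a => w i a).symm
  simp only [hw1, prod_const_one] at this
  rw [← this]
  refine sum_congr ?_ fun y _ => rfl
  ext y; simp

/-- **The probabilistic method under a product weight**: if the bad tuples have weight `< 1`,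
a good tuple exists. [folklore] -/
theorem exists_not_of_weight_lt_one {ι : Type*} [Fintype ι] [DecidableEq ι] {κ : ι → Type*} [∀ i, Fintype (κ i)]
    (w : ∀ i, κ i → ℝ) (hw1 : ∀ i, ∑ a, w i a = 1) (bad : (∀ i, κ i) → Prop) [DecidablePred bad]
    (h : ∑ y ∈ Finset.univ.filter bad, ∏ i, w i (y i) < 1) : ∃ y, ¬ bad y := by
  by_contra hall
  push Not at hall
  have : Finset.univ.filter bad = Finset.univ := by ext y; simp [hall y]
  rw [this, sum_prod_weights w hw1] at h
  exact lt_irrefl _ h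

/-- Sums over a union of events are at most the sum of the sums (nonnegative weights). [folklore] -/
theorem sum_biUnion_le_sum {α β : Type*} [DecidableEq β] (T : Finset α) (B : α → Finset β) (W : β → ℝ)
    (hW : ∀ b, 0 ≤ W b) : ∑ b ∈ T.biUnion B, W b ≤ ∑ a ∈ T, ∑ b ∈ B a, W b := by
  classical
  induction T using Finset.induction_on with
  | empty => simp
  | insert a T ha ih =>
    rw [Finset.biUnion_insert, Finset.sum_insert ha]
    have hu : ∑ b ∈ B a ∪ T.biUnion B, W b ≤ ∑ b ∈ B a, W b + ∑ b ∈ T.biUnion B, W b := by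
      rw [← Finset.sum_union_inter]
      have : 0 ≤ ∑ b ∈ B a ∩ T.biUnion B, W b := sum_nonneg fun b _ => hW b
      linarith
    linarith

/-! ### Sampling a majority vote from a distribution of predictors -/

section Sampling

variable {Ω : Type*} [Fintype Ω] {J : Type*} [Fintype J] [DecidableEq J]

/-- The `q`-weight of the predictors agreeing with `f` at `x`. [folklore] -/
def vote (g : J → Ω → Bool) (q : J → ℝ) (f : Ω → Bool) (x : Ω) : ℝ := ∑ j, q j * (if g j x = f x then 1 else 0)

/-- A strict majority of agreeing votes makes the majority gate agree. [folklore] -/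
theorem maj_eq_of_card_le {m : ℕ} (v : Fin (2 * m + 1) → Bool) (b : Bool)
    (h : m + 1 ≤ (Finset.univ.filter fun i => v i = b).card) : (GateFn.maj (2 * m + 1)).2 v = b := by
  change decide (2 * m + 1 ≤ 2 * GateFn.numOnes v) = b
  unfold GateFn.numOnes
  have htot : (Finset.univ.filter fun i => v i = true).card + (Finset.univ.filter fun i => v i = false).card = 2 * m + 1 := by
    have := Finset.card_filter_add_card_filter_not (s := (Finset.univ : Finset (Fin (2 * m + 1)))) (fun i => v i = true)
    simp only [Bool.not_eq_true, card_univ, Fintype.card_fin] at this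
    exact this
  cases b with
  | true => exact decide_eq_true (by omega)
  | false => exact decide_eq_false (by omega)

/-- **A majority of `2m+1` independent samples from the distribution is right wherever the vote is
`≥ 1/2 + ε`, for some fixed sample**, as soon as `|Ω| · exp(-(2m+1) ε²/2) < 1` (Hoeffding under
the product weight `q^{⊗(2m+1)}` at each such point, union bound over the points, probabilistic
method). This is the "standard amplification" of a randomized strategy of the circuit player in the
min-max argument (Goldreich–Nisan–Wigderson, *On Yao's XOR-Lemma*, App. A, proof of Claim 12.1;
Goldreich 2008, proof of Claim 7.21.1). [cite: AroraBarakCC2009, Thm. 19.2 (proof sketch: min-max and Chernoff)] -/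
theorem exists_majority_sample (g : J → Ω → Bool) (q : J → ℝ) (hq : ∀ j, 0 ≤ q j) (hq1 : ∑ j, q j = 1)
    (f : Ω → Bool) {ε : ℝ} (hε : 0 < ε) (m : ℕ)
    (hm : (Fintype.card Ω : ℝ) * Real.exp (-((2 * m + 1 : ℕ) * ε ^ 2 / 2)) < 1) :
    ∃ a : Fin (2 * m + 1) → J, ∀ x, 1 / 2 + ε ≤ vote g q f x →
      m + 1 ≤ (Finset.univ.filter fun i => g (a i) x = f x).card := by
  classical
  set t := 2 * m + 1 with ht
  -- bad samples at `x`: at most `m` agreeing votes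
  set badAt : Ω → Finset (Fin t → J) := fun x => Finset.univ.filter fun a =>
    (Finset.univ.filter fun i => g (a i) x = f x).card ≤ m with hbadAt
  set good : Finset Ω := Finset.univ.filter fun x => 1 / 2 + ε ≤ vote g q f x with hgood
  -- Hoeffding at each good point
  have hpt : ∀ x ∈ good, ∑ a ∈ badAt x, ∏ i, q (a i) ≤ Real.exp (-((t : ℕ) * ε ^ 2 / 2)) := by
    intro x hx
    rw [hgood, mem_filter] at hx
    set μ := vote g q f x with hμ
    have hμ1 : μ ≤ 1 := by
      rw [hμ, vote]
      calc ∑ j, q j * (if g j x = f x then (1:ℝ) else 0) ≤ ∑ j, q j := sum_le_sum fun j _ => by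
            split_ifs <;> nlinarith [hq j]
        _ = 1 := hq1
    have hμ0 : 0 ≤ μ := by rw [hμ, vote]; exact sum_nonneg fun j _ => by split_ifs <;> nlinarith [hq j]
    -- centered losses `μ - [agree]`
    have hH := hoeffding_weighted_pi (κ := fun _ : Fin t => J) (fun _ => q)
      (fun _ j => μ - (if g j x = f x then 1 else 0)) (fun _ => (1 : ℝ)) (fun _ j => hq j) (fun _ => hq1)
      (fun _ => by rw [show (fun j => q j * (μ - if g j x = f x then (1:ℝ) else 0)) = fun j => q j * μ - q j * (if g j x = f x then 1 else 0)
          from funext fun j => by ring, sum_sub_distrib, ← sum_mul, hq1, one_mul, hμ, vote, sub_self])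
      (fun _ j => by split_ifs <;> rw [abs_le] <;> constructor <;> linarith)
      (t := t * ε) (by positivity) (by simp; omega)
    have hexp : Real.exp (-((t * ε) ^ 2 / (2 * ∑ _i : Fin t, (1 : ℝ) ^ 2))) = Real.exp (-((t : ℕ) * ε ^ 2 / 2)) := by
      congr 1; simp [ht]; field_simp
    rw [hexp] at hH
    refine le_trans (sum_le_sum_of_subset_of_nonneg (fun a ha => ?_) fun a _ _ => prod_nonneg fun i _ => hq (a i)) hH
    rw [hbadAt, mem_filter] at ha
    rw [mem_filter]
    refine ⟨mem_univ _, ?_⟩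
    -- `Σ_i (μ - [agree_i]) = t μ - #agree ≥ t(1/2 + ε) - m ≥ t ε`
    have hcnt : ∑ i : Fin t, (if g (a i) x = f x then (1:ℝ) else 0) = ((Finset.univ.filter fun i => g (a i) x = f x).card : ℝ) := by
      rw [Finset.sum_boole]
    rw [sum_sub_distrib, sum_const, card_univ, Fintype.card_fin, nsmul_eq_mul, hcnt]
    have h2 : ((Finset.univ.filter fun i => g (a i) x = f x).card : ℝ) ≤ m := by exact_mod_cast ha.2
    have h3 : (t : ℝ) = 2 * m + 1 := by rw [ht]; push_cast; ring
    nlinarith [hx.2, h3]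
  -- union bound over the good points, then the probabilistic method
  obtain ⟨a, ha⟩ := exists_not_of_weight_lt_one (κ := fun _ : Fin t => J) (fun _ => q) (fun _ => hq1)
    (fun a => ∃ x ∈ good, a ∈ badAt x) (by
      have hsub : (Finset.univ.filter fun a : Fin t → J => ∃ x ∈ good, a ∈ badAt x) ⊆ good.biUnion badAt := by
        intro a ha; rw [mem_filter] at ha; exact Finset.mem_biUnion.2 ha.2
      calc ∑ y ∈ Finset.univ.filter (fun a : Fin t → J => ∃ x ∈ good, a ∈ badAt x), ∏ i, q (y i)
          ≤ ∑ y ∈ good.biUnion badAt, ∏ i, q (y i) :=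
            sum_le_sum_of_subset_of_nonneg hsub fun a _ _ => prod_nonneg fun i _ => hq (a i)
        _ ≤ ∑ x ∈ good, ∑ y ∈ badAt x, ∏ i, q (y i) := sum_biUnion_le_sum good badAt _ fun a => prod_nonneg fun i _ => hq (a i)
        _ ≤ ∑ _x ∈ good, Real.exp (-((t : ℕ) * ε ^ 2 / 2)) := sum_le_sum hpt
        _ ≤ (Fintype.card Ω : ℝ) * Real.exp (-((t : ℕ) * ε ^ 2 / 2)) := by
            rw [sum_const, nsmul_eq_mul]
            exact mul_le_mul_of_nonneg_right (by exact_mod_cast Finset.card_le_univ good) (Real.exp_pos _).le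
        _ < 1 := hm)
  refine ⟨a, fun x hx => ?_⟩
  by_contra hlt
  push Not at hlt
  exact ha ⟨x, mem_filter.2 ⟨mem_univ _, hx⟩, mem_filter.2 ⟨mem_univ _, Nat.lt_succ_iff.1 hlt⟩⟩

omit [Fintype J] [DecidableEq J] in
/-- **The majority circuit of the sample**: `x ↦ MAJ_i C_{a_i}(x)` has size `(2m+1) sz + 9m + 3`
and agrees with `f` wherever the vote is `≥ 1/2 + ε`. [folklore] -/
theorem cktSize_majority_sample {n : ℕ} (g : J → (Fin n → Bool) → Bool) {sz : ℕ}
    (hg : ∀ j, CktSize B2 (fun x (_ : Unit) => g j x) sz) (m : ℕ) (a : Fin (2 * m + 1) → J) :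
    CktSize B2 (fun x (_ : Unit) => (GateFn.maj (2 * m + 1)).2 fun i => g (a i) x) ((2 * m + 1) * sz + (9 * m + 3)) := by
  have h1 : CktSize B2 (fun (x : Fin n → Bool) (i : Fin (2 * m + 1)) => g (a i) x) ((2 * m + 1) * sz) := by
    have := CktSize.pi_const (κ := Fin (2 * m + 1)) fun i => hg (a i)
    rwa [Fintype.card_fin] at this
  exact h1.comp (cktSize_maj m)

end Sampling

/-! ### The hard-core measure (Claim 12.1: a dominated distribution on which `f` is strongly hard) -/

section Measure

variable {n : ℕ}

/-- **Impagliazzo's hard-core lemma, measure form** (Goldreich–Nisan–Wigderson, *On Yao's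
XOR-Lemma*, App. A, Claim 12.1; Goldreich 2008, Claim 7.21.1; here for the uniform distribution on
`{0,1}ⁿ` and `B₂`-circuits). If every circuit of size `≤ s` errs on at least `k ≥ 1` of the `2ⁿ`
inputs (`f` is `k/2ⁿ`-hard), then there is a probability distribution `p` on `{0,1}ⁿ` of density
`k` (`p(x) ≤ 1/k`, i.e. `p` is `k/2ⁿ`-dominated by the uniform distribution) under which every
circuit of size `≤ s'` agrees with `f` with probability `≤ 1/2 + ε` — provided the amplification
fits: `(2m+1) s' + 9m + 3 ≤ s` with `2ⁿ e^{-(2m+1)ε²/2} < 1` (e.g. `m = ⌈n/ε²⌉`).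
Proof: otherwise every such `p` has a good small circuit; in the game "`k`-subset vs. small
circuit" every mixed row strategy is such a `p`, so by the min-max principle
(`MinMax.exists_mixed_of_forall_mixed_lt`) some distribution `q` on small circuits wins `> 1/2 + ε`
against every `k`-subset; the points where the `q`-vote is `< 1/2 + ε` are then fewer than `k`,
and elsewhere a majority of `2m+1` samples from `q` computes `f` (`exists_majority_sample`) by a
circuit of size `≤ s` — contradicting the hardness. [cite: AroraBarakCC2009, Thm. 19.2 (Impagliazzo's hard-core lemma)] -/
theorem exists_hardCore_measure (f : (Fin n → Bool) → Bool) {k s s' m : ℕ} {ε : ℝ} (hε : 0 < ε)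
    (hk : 1 ≤ k) (hs' : 1 ≤ s') (hsize : (2 * m + 1) * s' + (9 * m + 3) ≤ s)
    (hm : (2 ^ n : ℝ) * Real.exp (-((2 * m + 1 : ℕ) * ε ^ 2 / 2)) < 1)
    (hhard : ∀ C : Circuit (Fin n), C.IsOver B2 → C.size ≤ s →
      k ≤ (Finset.univ.filter fun x => C.eval x ≠ f x).card) :
    ∃ p : (Fin n → Bool) → ℝ, (∀ x, 0 ≤ p x) ∧ ∑ x, p x = 1 ∧ (∀ x, p x ≤ 1 / k) ∧
      ∀ C : Circuit (Fin n), C.IsOver B2 → C.size ≤ s' →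
        ∑ x, p x * (if C.eval x = f x then 1 else 0) ≤ 1 / 2 + ε := by
  classical
  by_contra H
  push Not at H
  have hk0 : (0 : ℝ) < k := by exact_mod_cast hk
  -- the game: `k`-subsets against functions computed by circuits of size `≤ s'`
  let I := {S : Finset (Fin n → Bool) // S.card = k}
  let J := {g : (Fin n → Bool) → Bool // ∃ C : Circuit (Fin n), C.IsOver B2 ∧ C.size ≤ s' ∧ ∀ x, C.eval x = g x}
  haveI : Fintype J := Fintype.ofFinite J
  haveI : Nonempty J := by
    obtain ⟨C, hCB, hCs, hCe⟩ := (cktSize_const (Fin n) false).toCircuit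
    exact ⟨⟨fun _ => false, C, hCB, hCs.trans hs', hCe⟩⟩
  let A : I → J → ℝ := fun S g => (∑ x ∈ S.1, (if g.1 x = f x then (1 : ℝ) else 0)) / k
  -- every mixed row strategy is a dominated distribution, hence (by `H`) beaten by a pure column
  obtain ⟨q, hq0, hq1, hq⟩ := Literature.Analysis.Convex.MinMax.exists_mixed_of_forall_mixed_lt A (1 / 2 + ε)
    (fun w hw hw1 => by
      let p : (Fin n → Bool) → ℝ := fun x => (∑ S : I, w S * (if x ∈ S.1 then 1 else 0)) / k
      have hp0 : ∀ x, 0 ≤ p x := fun x => div_nonneg (sum_nonneg fun S _ => by split_ifs <;> nlinarith [hw S]) hk0.le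
      have hp1 : ∑ x, p x = 1 := by
        simp only [p]
        rw [← sum_div, sum_comm]
        have : ∀ S : I, ∑ x : Fin n → Bool, w S * (if x ∈ S.1 then (1:ℝ) else 0) = w S * k := fun S => by
          rw [← mul_sum, Finset.sum_boole]; simp [S.2]
        simp only [this, ← sum_mul, hw1, one_mul, div_self hk0.ne']
      have hpk : ∀ x, p x ≤ 1 / k := fun x => by
        simp only [p]
        rw [div_le_div_iff_of_pos_right hk0]
        calc ∑ S : I, w S * (if x ∈ S.1 then (1:ℝ) else 0) ≤ ∑ S : I, w S :=
              sum_le_sum fun S _ => by split_ifs <;> nlinarith [hw S]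
          _ = 1 := hw1
      obtain ⟨C, hCB, hCs, hC⟩ := H p hp0 hp1 hpk
      refine ⟨⟨fun x => C.eval x, C, hCB, hCs, fun x => rfl⟩, ?_⟩
      -- exchange the sums
      have : ∑ S : I, w S * A S ⟨fun x => C.eval x, C, hCB, hCs, fun x => rfl⟩ =
          ∑ x, p x * (if C.eval x = f x then 1 else 0) := by
        simp only [A, p]
        -- both sides are `(Σ_S Σ_x w_S [x ∈ S] [C x = f x]) / k`
        have lhs : ∀ S : I, w S * ((∑ x ∈ S.1, if C.eval x = f x then (1:ℝ) else 0) / k) =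
            (∑ x, w S * (if x ∈ S.1 then (1:ℝ) else 0) * (if C.eval x = f x then 1 else 0)) / k := fun S => by
          rw [mul_div_assoc', ← Finset.sum_filter_add_sum_filter_not Finset.univ (fun x => x ∈ S.1)]
          have h1 : (Finset.univ.filter fun x => x ∈ S.1) = S.1 := by ext x; simp
          have h2 : ∑ x ∈ Finset.univ.filter (fun x => ¬ x ∈ S.1), w S * (if x ∈ S.1 then (1:ℝ) else 0) *
              (if C.eval x = f x then 1 else 0) = 0 := sum_eq_zero fun x hx => by
            rw [mem_filter] at hx; simp [hx.2]
          rw [h1, h2, add_zero, mul_sum]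
          congr 1
          exact sum_congr rfl fun x hx => by simp [hx]
        have rhs : ∀ x : Fin n → Bool, (∑ S : I, w S * (if x ∈ S.1 then (1:ℝ) else 0)) / k * (if C.eval x = f x then 1 else 0) =
            (∑ S : I, w S * (if x ∈ S.1 then (1:ℝ) else 0) * (if C.eval x = f x then 1 else 0)) / k := fun x => by
          rw [div_mul_eq_mul_div, sum_mul]
        simp only [lhs, rhs, ← sum_div]
        rw [sum_comm]
      rw [this]; exact hC)
  -- the `q`-vote and the bad set
  let vt : (Fin n → Bool) → ℝ := vote (fun g : J => g.1) q f
  set B := Finset.univ.filter fun x : Fin n → Bool => vt x < 1 / 2 + ε with hB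
  have hAq : ∀ S : I, ∑ g : J, q g * A S g = (∑ x ∈ S.1, vt x) / k := fun S => by
    simp only [A, vt, vote]
    simp_rw [mul_div_assoc', ← sum_div, mul_sum]
    rw [sum_comm]
  have hBk : B.card < k := by
    by_contra hle
    push Not at hle
    obtain ⟨S, hS⟩ := (Finset.powersetCard_nonempty (s := B) (n := k)).2 hle
    rw [Finset.mem_powersetCard] at hS
    have h1 := hq ⟨S, hS.2⟩
    rw [hAq] at h1
    have hSne : S.Nonempty := Finset.card_pos.1 (by rw [hS.2]; exact hk)
    have h2 : ∑ x ∈ S, vt x < ∑ _x ∈ S, (1 / 2 + ε) :=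
      Finset.sum_lt_sum_of_nonempty hSne fun x hx => (mem_filter.1 (hS.1 hx)).2
    rw [sum_const, nsmul_eq_mul, hS.2] at h2
    have h3 : (∑ x ∈ S, vt x) / k < 1 / 2 + ε := by
      rw [div_lt_iff₀ hk0]; linarith
    simp only at h1
    linarith
  -- a majority of samples computes `f` off `B` by a circuit of size `≤ s`
  have hmΩ : (Fintype.card (Fin n → Bool) : ℝ) * Real.exp (-((2 * m + 1 : ℕ) * ε ^ 2 / 2)) < 1 := by
    rw [Fintype.card_fun, Fintype.card_bool, Fintype.card_fin]; exact_mod_cast hm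
  obtain ⟨a, ha⟩ := exists_majority_sample (fun g : J => g.1) q hq0 hq1 f hε m hmΩ
  have hg : ∀ g : J, CktSize B2 (fun x (_ : Unit) => g.1 x) s' := fun g => by
    obtain ⟨C, hCB, hCs, hCe⟩ := g.2
    exact ((C.cktSize_eval hCB).of_le hCs).congr fun x _ => hCe x
  obtain ⟨K, hKB, hKs, hKe⟩ := (cktSize_majority_sample (fun g : J => g.1) hg m a).toCircuit
  have hKf : ∀ x, x ∉ B → K.eval x = f x := fun x hx => by
    rw [hKe]
    refine maj_eq_of_card_le _ _ (ha x ?_)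
    rw [hB, mem_filter, not_and] at hx
    exact not_lt.1 (hx (mem_univ x))
  have hcnt := hhard K hKB (hKs.trans hsize)
  have hsub : (Finset.univ.filter fun x => K.eval x ≠ f x) ⊆ B := fun x hx => by
    by_contra hxB
    exact (mem_filter.1 hx).2 (hKf x hxB)
  exact absurd (hcnt.trans (card_le_card hsub)) (not_le.2 hBk)

end Measure

end HardCoreMinMax

end Literature.Computability.Complexity

end
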